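import Mathlib
import Literature.Probability.Process.PointStationaryLaw
import Literature.MathematicalPhysics.StatisticalMechanics.RootEnergy
import Summits.AtomisticToContinuum.Crystallization.Theses.PalmUnimodularRigidity
import Summits.AtomisticToContinuum.Crystallization.Theorems.PalmUnimodularRigidityUnimodularEnergyLowerBoundHardCore
import Summits.AtomisticToContinuum.Crystallization.Theorems.PalmUnimodularRigidityUnimodularEnergyLowerBoundTransport
import Summits.AtomisticToContinuum.Crystallization.Theorems.PalmUnimodularRigidityUnimodularEnergyLowerBoundCluster
import Summits.AtomisticToContinuum.Crystallization.Theorems.PalmUnimodularRigidityUnimodularEnergyLowerBoundTail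
import HarnessLib

/-!
# `UnimodularEnergyLowerBound` (item `stmt-AtomisticToContinuum-9229`, route `PalmUnimodularRigidity`)

**Theorem** (`e_uni ≥ e*`).  For every hard core `δ > 0` and every probability law `P` on rooted
`δ`-hard-core configurations of `ℝ³` (`μ = count|S`, `0 ∈ S`, `S` `δ`-separated) which is
POINT-STATIONARY (Mecke / mass-transport identity, `Literature.Probability.Process.IsPointStationaryLaw`),
the expected energy of the root is at least the periodic ground-state energy per particle:

`e* := ⨅_{Q periodic} e_LJ(Q) ≤ E_P[h]`, `h(μ) = ½ ∫ V_LJ(‖y‖) dμ(y)`.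

No intensity, ergodicity or "no foam" hypothesis is needed.  This is the energy analogue of
Bowen–Radin's identification of the optimal packing density over invariant / Palm-type measures with
the classical one (Discrete Comput. Geom. 29 (2003)); the statement for Lennard-Jones energies and the
proof below are this route's.

**Proof** (mass transport through ball centres, no external randomness).  Fix `R > 0`.  The root of
`μ` spreads unit "attention" over the centres `v ∈ B(0,R)`; a centre `v` redistributes whatever it
receives evenly among the `N_v = #(S ∩ B(v,R)) ≥ 1` configuration points of its ball.  Transporting
the payload `F(μ, v)` this way is translation-covariant, so the Mecke identity gives
(`lintegral_mass_transport_ball`)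
`E_P ∫_{B(0,R)} F(μ,v) dv = E_P ∫_{B(0,R)} N_v⁻¹ Σ_{y ∈ S ∩ B(v,R)} F(θ_y μ, v - y) dv`.
Apply it to `F_B(μ, v) = Σ_z V⁻(‖z‖)` (attraction felt by the root) and to
`F_A(μ, v) = Σ_z V⁺(‖z‖) + 2(-e*) + Σ_{z ∉ B(v,R)} V⁻(‖z‖)` (repulsion, the periodic constant, and the
attraction from OUTSIDE the ball).  On the right-hand sides both payloads are summed over the points
of a common ball `S ∩ B(v,R)`, and there `Σ F_B ≤ Σ F_A` is exactly the cluster inequality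
`2 E_LJ(S ∩ B(v,R)) ≥ N_v · e*` (periodisation, `card_mul_eStar_le_interactionEnergy` with item 0714
`bddBelow_energyPerParticle_lennardJones`) — the interactions with the outside cancel identically
(`setLIntegral_ball_cluster_le`).  Hence `vol(B_R)·E[Σ V⁻] ≤ vol(B_R)·(E[Σ V⁺] + 2(-e*)) + error(R)`
with `error(R)/vol(B_R) = E_P Σ_z V⁻(‖z‖) θ_R(z)`, `θ_R(z) = vol(B(0,R)∖B(z,R))/vol(B_R) → 0`,
which tends to `0` by dominated convergence (`…Tail`), the sums `Σ V^±` being uniformly bounded on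
`δ`-hard-core configurations (`…HardCore`).  So `E[Σ V⁻] ≤ E[Σ V⁺] - 2e*`, i.e. `E_P[h] ≥ e*`.
Joint measurability of the transport in `(μ, v)` is obtained through an s-finite kernel equal to the
identity on hard-core configurations (`…Transport`, Part 1).

Main declarations: `UnimodularEnergy.eStar_le_integral_rootEnergy` (Literature vocabulary:
`IsRootedHardCore`, `IsPointStationaryLaw`, `rootEnergy`) and the route-decl closer
`unimodularEnergyLowerBound_proof`.  All `[folklore]` bookkeeping around the two cited inputs.
-/

noncomputable section

namespace Summit.AtomisticToContinuum.Crystallization.Theorems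

open MeasureTheory Metric Set Filter ProbabilityTheory
open scoped ENNReal Topology
open Literature.MathematicalPhysics.StatisticalMechanics Literature.Probability.Process
open Summit.AtomisticToContinuum.Crystallization.Theorems.ChargedEnergyGapNegative (E3 eStar)

namespace UnimodularEnergy

section Main

variable {δ : ℝ} {P : Measure (Measure E3)}

/-- **Step 1 (one radius).** For a point-stationary probability law carried by rooted `δ`-hard-core
configurations and every `R > 0`:
`E[Σ V⁻] ≤ E[Σ V⁺] + 2(-e*) + vol(B_R)⁻¹ · E ∫_{B(0,R)} Σ_{z ∉ B(v,R)} V⁻(‖z‖) dv`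
(the two mass transports and the cluster inequality). [folklore] -/
theorem lintegral_neg_le_lintegral_pos_add (hδ : 0 < δ) [IsProbabilityMeasure P]
    (κ : Kernel (Measure E3) E3) [IsSFiniteKernel κ]
    (hκ : ∀ μ : Measure E3, IsRootedHardCore δ μ → κ μ = μ)
    (hcore : ∀ᵐ μ ∂P, IsRootedHardCore δ μ) (hstat : IsPointStationaryLaw P) {R : ℝ} (hR : 0 < R) :
    ∫⁻ μ, (∫⁻ z, ENNReal.ofReal (-lennardJones ‖z‖) ∂(κ μ)) ∂P ≤
      ∫⁻ μ, (∫⁻ z, ENNReal.ofReal (lennardJones ‖z‖) ∂(κ μ)) ∂P + 2 * ENNReal.ofReal (-eStar) +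
        (∫⁻ μ, (∫⁻ v in ball (0 : E3) R, ∫⁻ z in (ball v R)ᶜ, ENNReal.ofReal (-lennardJones ‖z‖) ∂(κ μ))
          ∂P) / volume (ball (0 : E3) R) := by
  set m : E3 → ℝ≥0∞ := fun z => ENNReal.ofReal (-lennardJones ‖z‖) with hm_def
  set p : E3 → ℝ≥0∞ := fun z => ENNReal.ofReal (lennardJones ‖z‖) with hp_def
  have hm : Measurable m := measurable_ofReal_neg_lennardJones_norm
  have hp : Measurable p := measurable_ofReal_lennardJones_norm
  set c : ℝ≥0∞ := 2 * ENNReal.ofReal (-eStar) with hc_def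
  set V : ℝ≥0∞ := volume (ball (0 : E3) R) with hV_def
  have hV0 : V ≠ 0 := (measure_ball_pos volume (0 : E3) hR).ne'
  have hVtop : V ≠ ∞ := measure_ball_lt_top.ne
  -- the two payloads
  set FA : Measure E3 → E3 → ℝ≥0∞ := fun ν w =>
    (∫⁻ z, p z ∂(κ ν)) + c + ∫⁻ z in (ball w R)ᶜ, m z ∂(κ ν) with hFA_def
  set FB : Measure E3 → E3 → ℝ≥0∞ := fun ν _ => ∫⁻ z, m z ∂(κ ν) with hFB_def
  have hFA : Measurable (Function.uncurry FA) := by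
    show Measurable fun q : Measure E3 × E3 =>
      (∫⁻ z, p z ∂(κ q.1)) + c + ∫⁻ z in (ball q.2 R)ᶜ, m z ∂(κ q.1)
    exact ((hp.lintegral_kernel.comp measurable_fst).add measurable_const).add
      (measurable_setLIntegral_kernel_compl_ball κ hm R)
  have hFB : Measurable (Function.uncurry FB) := by
    show Measurable fun q : Measure E3 × E3 => ∫⁻ z, m z ∂(κ q.1)
    exact hm.lintegral_kernel.comp measurable_fst
  have hA := lintegral_mass_transport_ball hδ κ hκ hcore hstat R hFA
  have hB := lintegral_mass_transport_ball hδ κ hκ hcore hstat R hFB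
  -- received sides: the cluster inequality
  have hrecv : ∫⁻ μ, (∫⁻ v in ball (0 : E3) R,
      (∫⁻ y in ball v R, FB (μ.map fun z => z - y) (v - y) ∂μ) / μ (ball v R)) ∂P ≤
      ∫⁻ μ, (∫⁻ v in ball (0 : E3) R,
        (∫⁻ y in ball v R, FA (μ.map fun z => z - y) (v - y) ∂μ) / μ (ball v R)) ∂P := by
    refine lintegral_mono_ae (hcore.mono fun μ hμ => ?_)
    refine lintegral_mono fun v => ENNReal.div_le_div_right ?_ _
    have hμ' := hμ
    obtain ⟨S, h0, hsep, rfl⟩ := hμ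
    have hS := countable_of_separated hδ hsep
    have hae := ae_restrict_of_ae (s := ball v R) (ae_mem_count_restrict hS)
    have haeB : ∀ᵐ y ∂(((Measure.count : Measure E3).restrict S).restrict (ball v R)),
        FB (((Measure.count : Measure E3).restrict S).map fun z => z - y) (v - y) =
          ∫⁻ z, ENNReal.ofReal (-lennardJones ‖z - y‖) ∂((Measure.count : Measure E3).restrict S) := by
      refine hae.mono fun y hy => ?_
      have hκy := hκ _ (hμ'.map_sub ((count_restrict_singleton_ne_zero_iff S y).2 hy))
      simp only [hFB_def]
      rw [hκy, lintegral_map_sub _ _ hm]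
    have haeA : ∀ᵐ y ∂(((Measure.count : Measure E3).restrict S).restrict (ball v R)),
        FA (((Measure.count : Measure E3).restrict S).map fun z => z - y) (v - y) =
          ∫⁻ z, ENNReal.ofReal (lennardJones ‖z - y‖) ∂((Measure.count : Measure E3).restrict S) +
            2 * ENNReal.ofReal (-eStar) +
            ∫⁻ z in (ball v R)ᶜ, ENNReal.ofReal (-lennardJones ‖z - y‖)
              ∂((Measure.count : Measure E3).restrict S) := by
      refine hae.mono fun y hy => ?_
      have hκy := hκ _ (hμ'.map_sub ((count_restrict_singleton_ne_zero_iff S y).2 hy))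
      simp only [hFA_def]
      rw [hκy, lintegral_map_sub _ _ hp, setLIntegral_compl_ball_map_sub _ _ _ _ hm, sub_add_cancel]
    rw [lintegral_congr_ae haeB, lintegral_congr_ae haeA]
    exact setLIntegral_ball_cluster_le hδ hsep v R
  -- sent sides
  have hsentB : ∫⁻ μ, (∫⁻ v in ball (0 : E3) R, FB μ v) ∂P = (∫⁻ μ, (∫⁻ z, m z ∂(κ μ)) ∂P) * V := by
    simp only [hFB_def, setLIntegral_const]
    rw [lintegral_mul_const _ hm.lintegral_kernel]
  have hsentA : ∫⁻ μ, (∫⁻ v in ball (0 : E3) R, FA μ v) ∂P =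
      (∫⁻ μ, (∫⁻ z, p z ∂(κ μ)) ∂P) * V + c * V +
        ∫⁻ μ, (∫⁻ v in ball (0 : E3) R, ∫⁻ z in (ball v R)ᶜ, m z ∂(κ μ)) ∂P := by
    have h1 : ∀ μ : Measure E3, ∫⁻ v in ball (0 : E3) R, FA μ v =
        ((∫⁻ z, p z ∂(κ μ)) + c) * V + ∫⁻ v in ball (0 : E3) R, ∫⁻ z in (ball v R)ᶜ, m z ∂(κ μ) := by
      intro μ
      simp only [hFA_def]
      rw [lintegral_add_left measurable_const, setLIntegral_const]
    simp_rw [h1]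
    have hmeas2 : Measurable fun μ : Measure E3 => (∫⁻ z, p z ∂(κ μ)) + c :=
      hp.lintegral_kernel.add measurable_const
    have hmeas1 : Measurable fun μ : Measure E3 => ((∫⁻ z, p z ∂(κ μ)) + c) * V :=
      hmeas2.mul_const _
    rw [lintegral_add_left hmeas1, lintegral_mul_const _ hmeas2,
      lintegral_add_left hp.lintegral_kernel, lintegral_const, measure_univ, mul_one, add_mul]
  -- combine: sent_B = received_B ≤ received_A = sent_A
  have hineq : (∫⁻ μ, (∫⁻ z, m z ∂(κ μ)) ∂P) * V ≤
      (∫⁻ μ, (∫⁻ z, p z ∂(κ μ)) ∂P) * V + c * V +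
        ∫⁻ μ, (∫⁻ v in ball (0 : E3) R, ∫⁻ z in (ball v R)ᶜ, m z ∂(κ μ)) ∂P := by
    rw [← hsentB, hB, ← hsentA, hA]
    exact hrecv
  -- divide by the volume
  calc ∫⁻ μ, (∫⁻ z, m z ∂(κ μ)) ∂P
      = (∫⁻ μ, (∫⁻ z, m z ∂(κ μ)) ∂P) * V / V := (ENNReal.mul_div_cancel_right hV0 hVtop).symm
    _ ≤ ((∫⁻ μ, (∫⁻ z, p z ∂(κ μ)) ∂P) * V + c * V +
          ∫⁻ μ, (∫⁻ v in ball (0 : E3) R, ∫⁻ z in (ball v R)ᶜ, m z ∂(κ μ)) ∂P) / V :=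
        ENNReal.div_le_div_right hineq _
    _ = ∫⁻ μ, (∫⁻ z, p z ∂(κ μ)) ∂P + c +
          (∫⁻ μ, (∫⁻ v in ball (0 : E3) R, ∫⁻ z in (ball v R)ᶜ, m z ∂(κ μ)) ∂P) / V := by
        rw [ENNReal.add_div, ENNReal.add_div, ENNReal.mul_div_cancel_right hV0 hVtop,
          ENNReal.mul_div_cancel_right hV0 hVtop]

/-- The error term of Step 1 along `R = n + 1` is the expectation of `Σ_z V⁻(‖z‖) θ_{n+1}(z)`.
[folklore] -/
theorem error_term_eq (hδ : 0 < δ) (κ : Kernel (Measure E3) E3) [IsSFiniteKernel κ]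
    (hκ : ∀ μ : Measure E3, IsRootedHardCore δ μ → κ μ = μ)
    (hcore : ∀ᵐ μ ∂P, IsRootedHardCore δ μ) (n : ℕ) :
    (∫⁻ μ, (∫⁻ v in ball (0 : E3) ((n : ℝ) + 1), ∫⁻ z in (ball v ((n : ℝ) + 1))ᶜ,
        ENNReal.ofReal (-lennardJones ‖z‖) ∂(κ μ)) ∂P) / volume (ball (0 : E3) ((n : ℝ) + 1)) =
      ∫⁻ μ, (∫⁻ z, ENNReal.ofReal (-lennardJones ‖z‖) *
        (volume (ball (0 : E3) ((n : ℝ) + 1) \ ball z ((n : ℝ) + 1)) /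
          volume (ball (0 : E3) ((n : ℝ) + 1))) ∂(κ μ)) ∂P := by
  set R : ℝ := (n : ℝ) + 1 with hR
  set m : E3 → ℝ≥0∞ := fun z => ENNReal.ofReal (-lennardJones ‖z‖) with hm_def
  have hm : Measurable m := measurable_ofReal_neg_lennardJones_norm
  have hswap : ∀ᵐ μ ∂P, ∫⁻ v in ball (0 : E3) R, (∫⁻ z in (ball v R)ᶜ, m z ∂(κ μ)) =
      ∫⁻ z, m z * volume (ball (0 : E3) R \ ball z R) ∂(κ μ) := hcore.mono fun μ hμ => by
    have hκμ := hκ μ hμ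
    obtain ⟨S, h0, hsep, rfl⟩ := hμ
    rw [hκμ]
    exact setLIntegral_ball_setLIntegral_compl_ball (countable_of_separated hδ hsep) R m
  have hmeas3 : Measurable fun z : E3 => m z * volume (ball (0 : E3) R \ ball z R) :=
    hm.mul (measurable_volume_ball_diff R)
  have hmeas4 : Measurable fun μ : Measure E3 =>
      ∫⁻ z, m z * volume (ball (0 : E3) R \ ball z R) ∂(κ μ) := hmeas3.lintegral_kernel
  rw [lintegral_congr_ae hswap, ENNReal.div_eq_inv_mul, ← lintegral_const_mul _ hmeas4]
  refine lintegral_congr fun μ => ?_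
  rw [← lintegral_const_mul _ hmeas3]
  refine lintegral_congr fun z => ?_
  rw [ENNReal.div_eq_inv_mul]
  simp only [hm_def]
  ring

/-- **`e_uni ≥ e*`** in Literature vocabulary: for `δ > 0` and a point-stationary probability law
`P` on rooted `δ`-hard-core configurations of `ℝ³`, `e* ≤ E_P[rootEnergy lennardJones]`, i.e.
`⨅_Q e_LJ(Q) ≤ ∫ ½ ∫ V_LJ(‖y‖) dμ(y) dP(μ)`. [folklore] -/
theorem eStar_le_integral_rootEnergy (hδ : 0 < δ) [IsProbabilityMeasure P]
    (hcore : ∀ᵐ μ ∂P, IsRootedHardCore δ μ) (hstat : IsPointStationaryLaw P) :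
    eStar ≤ ∫ μ, (∫ y, lennardJones ‖y‖ ∂μ) / 2 ∂P := by
  obtain ⟨κ, hκs, hκ⟩ := exists_kernel_eq_self hδ
  set m : E3 → ℝ≥0∞ := fun z => ENNReal.ofReal (-lennardJones ‖z‖) with hm_def
  set p : E3 → ℝ≥0∞ := fun z => ENNReal.ofReal (lennardJones ‖z‖) with hp_def
  have hm : Measurable m := measurable_ofReal_neg_lennardJones_norm
  have hp : Measurable p := measurable_ofReal_lennardJones_norm
  set Hp : Measure E3 → ℝ≥0∞ := fun ν => ∫⁻ z, p z ∂(κ ν) with hHp_def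
  set Hm : Measure E3 → ℝ≥0∞ := fun ν => ∫⁻ z, m z ∂(κ ν) with hHm_def
  have hHp : Measurable Hp := hp.lintegral_kernel
  have hHm : Measurable Hm := hm.lintegral_kernel
  set Cp : ℝ≥0∞ := ENNReal.ofReal (250 / 12 * δ⁻¹ ^ 12) with hCp
  set Cm : ℝ≥0∞ := ENNReal.ofReal (250 / 6 * δ⁻¹ ^ 6) with hCm
  -- uniform bounds
  have hbp : ∀ᵐ μ ∂P, Hp μ ≤ Cp := hcore.mono fun μ hμ => by
    have hκμ := hκ μ hμ
    obtain ⟨S, h0, hsep, rfl⟩ := hμ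
    simp only [hHp_def, hκμ]
    simpa only [sub_zero] using lintegral_ofReal_lennardJones_le hδ hsep h0
  have hbm : ∀ᵐ μ ∂P, Hm μ ≤ Cm := hcore.mono fun μ hμ => by
    have hκμ := hκ μ hμ
    obtain ⟨S, h0, hsep, rfl⟩ := hμ
    simp only [hHm_def, hκμ]
    simpa only [sub_zero] using lintegral_ofReal_neg_lennardJones_le hδ hsep h0
  have hfinp : ∫⁻ μ, Hp μ ∂P ≠ ∞ := by
    refine ((lintegral_mono_ae hbp).trans_lt ?_).ne
    rw [lintegral_const, measure_univ, mul_one]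
    exact ENNReal.ofReal_lt_top
  have hfinm : ∫⁻ μ, Hm μ ∂P ≠ ∞ := by
    refine ((lintegral_mono_ae hbm).trans_lt ?_).ne
    rw [lintegral_const, measure_univ, mul_one]
    exact ENNReal.ofReal_lt_top
  -- Step 1 along `R = n + 1`, and the limit
  set T : ℕ → ℝ≥0∞ := fun n => ∫⁻ μ, (∫⁻ z, m z *
      (volume (ball (0 : E3) ((n : ℝ) + 1) \ ball z ((n : ℝ) + 1)) /
        volume (ball (0 : E3) ((n : ℝ) + 1))) ∂(κ μ)) ∂P with hT_def
  have hstep : ∀ n : ℕ, ∫⁻ μ, Hm μ ∂P ≤ ∫⁻ μ, Hp μ ∂P + 2 * ENNReal.ofReal (-eStar) + T n := by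
    intro n
    have h := lintegral_neg_le_lintegral_pos_add hδ κ hκ hcore hstat (R := (n : ℝ) + 1)
      (by positivity)
    rwa [error_term_eq hδ κ hκ hcore n] at h
  have hT : Tendsto T atTop (𝓝 0) :=
    tendsto_lintegral_lintegral_neg_lennardJones_mul hδ κ hκ hcore
  have hlim : ∫⁻ μ, Hm μ ∂P ≤ ∫⁻ μ, Hp μ ∂P + 2 * ENNReal.ofReal (-eStar) := by
    have h2 : Tendsto (fun n => ∫⁻ μ, Hp μ ∂P + 2 * ENNReal.ofReal (-eStar) + T n) atTop
        (𝓝 (∫⁻ μ, Hp μ ∂P + 2 * ENNReal.ofReal (-eStar) + 0)) :=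
      tendsto_const_nhds.add hT
    rw [add_zero] at h2
    exact ge_of_tendsto' h2 hstep
  -- the root energy as a difference of the two functionals
  have hae : ∀ᵐ μ ∂P, (∫ y, lennardJones ‖y‖ ∂μ) / 2 = ((Hp μ).toReal - (Hm μ).toReal) / 2 :=
    hcore.mono fun μ hμ => by
      have hκμ := hκ μ hμ
      have hμ' := hμ
      obtain ⟨S, h0, hsep, rfl⟩ := hμ
      have hint : Integrable (fun y : E3 => lennardJones ‖y‖)
          ((Measure.count : Measure E3).restrict S) := by
        refine ⟨(measurable_lennardJones.comp measurable_norm).aestronglyMeasurable, ?_⟩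
        show ∫⁻ y, ‖lennardJones ‖y‖‖ₑ ∂((Measure.count : Measure E3).restrict S) < ∞
        calc ∫⁻ y, ‖lennardJones ‖y‖‖ₑ ∂((Measure.count : Measure E3).restrict S)
            ≤ ∫⁻ y, (p y + m y) ∂((Measure.count : Measure E3).restrict S) :=
              lintegral_mono fun y => by
                simp only [hp_def, hm_def]
                rw [Real.enorm_eq_ofReal_abs]
                rcases le_total 0 (lennardJones ‖y‖) with h | h
                · rw [abs_of_nonneg h]; exact le_self_add
                · rw [abs_of_nonpos h]; exact le_add_self
          _ = (∫⁻ y, p y ∂((Measure.count : Measure E3).restrict S)) +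
                ∫⁻ y, m y ∂((Measure.count : Measure E3).restrict S) := lintegral_add_left hp _
          _ < ∞ := by
              refine ENNReal.add_lt_top.2 ⟨?_, ?_⟩
              · have := lintegral_ofReal_lennardJones_le hδ hsep h0
                simp only [sub_zero] at this
                exact this.trans_lt ENNReal.ofReal_lt_top
              · have := lintegral_ofReal_neg_lennardJones_le hδ hsep h0
                simp only [sub_zero] at this
                exact this.trans_lt ENNReal.ofReal_lt_top
      rw [integral_eq_lintegral_pos_part_sub_lintegral_neg_part hint]
      simp only [hHp_def, hHm_def, hκμ, hp_def, hm_def]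
  rw [integral_congr_ae hae]
  have hintp : Integrable (fun μ => (Hp μ).toReal) P := by
    refine Integrable.of_bound hHp.ennreal_toReal.aestronglyMeasurable Cp.toReal
      (hbp.mono fun μ h => ?_)
    rw [Real.norm_eq_abs, abs_of_nonneg ENNReal.toReal_nonneg]
    exact ENNReal.toReal_mono ENNReal.ofReal_ne_top h
  have hintm : Integrable (fun μ => (Hm μ).toReal) P := by
    refine Integrable.of_bound hHm.ennreal_toReal.aestronglyMeasurable Cm.toReal
      (hbm.mono fun μ h => ?_)
    rw [Real.norm_eq_abs, abs_of_nonneg ENNReal.toReal_nonneg]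
    exact ENNReal.toReal_mono ENNReal.ofReal_ne_top h
  rw [integral_div, integral_sub hintp hintm,
    integral_toReal hHp.aemeasurable (hbp.mono fun μ h => h.trans_lt ENNReal.ofReal_lt_top),
    integral_toReal hHm.aemeasurable (hbm.mono fun μ h => h.trans_lt ENNReal.ofReal_lt_top)]
  -- pass to real numbers
  have he : 0 ≤ -eStar := neg_nonneg.2 eStar_nonpos
  have hreal : (∫⁻ μ, Hm μ ∂P).toReal ≤ (∫⁻ μ, Hp μ ∂P).toReal + 2 * (-eStar) := by
    have hne : ∫⁻ μ, Hp μ ∂P + 2 * ENNReal.ofReal (-eStar) ≠ ∞ :=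
      ENNReal.add_ne_top.2 ⟨hfinp, ENNReal.mul_ne_top (by simp) ENNReal.ofReal_ne_top⟩
    have h := ENNReal.toReal_mono hne hlim
    rwa [ENNReal.toReal_add hfinp (ENNReal.mul_ne_top (by simp) ENNReal.ofReal_ne_top),
      ENNReal.toReal_mul, ENNReal.toReal_ofReal he, ENNReal.toReal_ofNat] at h
  linarith

end Main

end UnimodularEnergy

/-- **Item `stmt-AtomisticToContinuum-9229` (`UnimodularEnergyLowerBound`)**: every point-stationary
hard-core probability law on rooted configurations of `ℝ³` has expected root energy at least
`e* = ⨅_Q e_LJ(Q)` (`e_uni ≥ e*`, no intensity / no-foam hypothesis).  The route decl, by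
`UnimodularEnergy.eStar_le_integral_rootEnergy`. [folklore] -/
theorem unimodularEnergyLowerBound_proof :
    Summit.AtomisticToContinuum.Crystallization.Theses.PalmUnimodularRigidity.UnimodularEnergyLowerBound := by
  intro δ hδ P hP hcore hstat
  exact UnimodularEnergy.eStar_le_integral_rootEnergy hδ hcore hstat

end Summit.AtomisticToContinuum.Crystallization.Theorems

end
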